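import Summits.CriticalPhenomena.PercolationContinuityZ3.Theses.PercDivergentSlabLadder
import Literature.Probability.Percolation.RSW

/-!
# Birth skeleton (BC3) for the crux `ConeRung` (stmt-CriticalPhenomena-6701)

Route `route-CriticalPhenomena-PercDivergentSlabLadder` (sub-problem `PercolationContinuityZ3`), crux decl
`Summit.CriticalPhenomena.PercolationContinuityZ3.Theses.PercDivergentSlabLadder.ConeRung` (rank 5, frame
crux, top of the filed rung ladder): for every `m`, bond percolation on the induced graph of
`V_m = {z ∈ ℤ³ : |z₀| ≤ m · ρ(z)}`, `ρ(z) = max(|z₁|,|z₂|)` (ℤ³ minus the thin double cone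
`{ρ < |z₀|/m}` about the `x₀`-axis), has `θ = 0` at every vertex at `p = p_c(ℤ³)`.

THE LINE (the route header's TWO-LAYER PLAN for this node, verbatim: "ConeRung ⇐ FlatAnnulusCrossingAll
(∀ aspect m ∃ c_m: washers {|z_0| ≤ k, R ≤ ρ ≤ 2R}, k ≤ mR, crossed w.p. ≤ 1 − c_m) → ConeRungGlue
(dyadic independence, as SmallConeRungOfFlatAnnulus) → ConeRung"), cut into three registered stubs:

* STUB 1 `stub_washerCrossingAllAspects` (XL, OPEN — LOAD-BEARING; = `FlatAnnulusCrossingAll`):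
  **RSW upper bound for flat washers of EVERY aspect, uniformly in the scale** — for every `m` there is
  `c_m > 0` such that for all `R ≥ 1` the washer `W_m(R) = {|z₀| ≤ m R, R ≤ ρ ≤ 2R}` is crossed
  radially inside itself (an open path from `ρ = R` to `ρ = 2R`) with `P_{p_c(ℤ³)}`-probability
  `≤ 1 − c_m`. At aspect `≤ 1/M` it is the route's crux `FlatAnnulusCrossing` (indeed STUB 1 ⟹
  `FlatAnnulusCrossing` with `M = 1`, `flatAnnulusCrossing_of_washerAll` below, sorry-free); the passage
  from one flat aspect to all aspects is the route's foreseen "AspectLifting" child (the genuinely 3D step).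
  NOT a consequence of the crux or of the conjunct (a uniform crossing bound, `X_B`-type in flat/conical
  geometry): false iff for some aspect the washers get crossed with probability `→ 1` along `R_j → ∞`
  (the `d > 6` behaviour, `Literature.Barriers.CriticalPhenomena.SpanningClustersAboveSix`).
* STUB 2 `stub_coneArmDecayOfWashers` (M, PROVABLE NOW — the dyadic glue): STUB 1 ⟹ for every `m` and
  every `x ∈ V_m`, `P_{p_c}(x ↔ {ρ ≥ n} inside V_m) → 0` as `n → ∞`. Proof sketch: a.s. `ω ⊆ E(ℤ³)`, so an
  open path inside `V_m` from `x` (`ρ(x) = r₀`) to lateral radius `≥ n` moves `ρ` by `≤ 1` per step and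
  therefore contains, for every `i` with `r₀ < 4^i` and `2·4^i ≤ n`, a radial crossing of
  `V_m ∩ {4^i ≤ ρ ≤ 2·4^i} ⊆ W_{2m}(4^i)` (`|z₀| ≤ m ρ ≤ 2m·4^i`); these washers are pairwise
  vertex-disjoint (`2·4^i < 4^{i+1}`), the crossing events are determined by disjoint edge sets, hence
  independent under the product measure (`DeterminedBy` / `bondPercolation` independence tools of
  `FiniteEnergy.lean`, `ConstrainedClusters.lean`), so the probability is `≤ (1 − c_{2m})^{#i} → 0`
  (the dyadic-annulus argument of NTW arXiv:1512.09107 §3.8; same shape as the route's support item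
  `SmallConeRungOfFlatAnnulus`).
* STUB 3 `stub_thetaConeLeArm` (S/M, PROVABLE NOW — the coupling): for every `m`, `n` and `x ∈ V_m`,
  `θ_{ℤ³[V_m]}(x, p_c) ≤ P_{p_c}(x ↔ {ρ ≥ n} inside V_m)`. Proof sketch:
  `theta_induce_eq_real_percolatesVia` (θ of the induced graph = probability of an infinite cluster of
  steps inside `V_m`), an infinite constrained cluster leaves the FINITE set `V_m ∩ {ρ < n}`
  (`|z₀| ≤ m ρ < m n`), and `openConnVia (withinGraph G V_m) ⊆ openConnIn V_m`
  (`openConnIn_eq_openConnVia`, `withinGraph_le`/monotonicity).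

Composition (kernel-checked, no `sorry`): `ConeRung_of : stub_washerCrossingAllAspects →
stub_coneArmDecayOfWashers → stub_thetaConeLeArm → ConeRung` — `θ ≥ 0` (`measureReal_nonneg`) and
`θ ≤ a_n → 0` (`ge_of_tendsto'`). Hypotheses are typed by the name-keyed aliases `__Registered.stub_*`
(device of `Cruxes/BGNOffTheFloor/Lines/birth.lean`; the `@[stub]` attribute is gate-reserved).

DISPROOF USED: none exists for this crux (`ledger crux ls stmt-CriticalPhenomena-6701`: no workfiles, no
`Disproof.lean`, no landed Negative lemma, 2026-08-17). Negatives index: the summit's refuted statements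
are not cone/washer statements. Degenerate instances: `m = 0` — `V_0` is the coordinate plane `{z₀ = 0}`
at `p_c(ℤ³) < 1/2 = p_c(ℤ²)` (TRUE, essentially known: refuters g41-18/g41-59, grounder g17-0); STUB 1 at
`m = 0` is planar subcritical RSW; `R = 0` is excluded (`1 ≤ R`: at `R = 0` the "washer" is a point and
the crossing event is sure).
-/

noncomputable section

namespace Summit.CriticalPhenomena.PercolationContinuityZ3.Cruxes.ConeRung.Birth

open MeasureTheory Filter Literature.Probability.Percolation Literature.Probability.LatticeModels
open Summit.CriticalPhenomena.PercolationContinuityZ3.Theses.PercDivergentSlabLadder (ConeRung FlatAnnulusCrossing)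

/-! ## Objects of the line -/

/-- The critical bond percolation measure on `ℤ³`, `P_{p_c(ℤ³)}`. -/
abbrev μc : Measure (BondConfig (Site 3)) := bondPercolation (zdGraph 3) (criticalProbI 3)

/-- The cone complement `V_m = {z : |z₀| ≤ m · max(|z₁|,|z₂|)}` — VERBATIM the set of the crux
(`abbrev`, so that `↥(cone m)` and the crux's subtype agree reducibly). -/
abbrev cone (m : ℕ) : Set (Site 3) := {z : Site 3 | |z 0| ≤ (m : ℤ) * max |z 1| |z 2|}

/-- The flat washer `W_m(R) = {|z₀| ≤ m R, R ≤ ρ ≤ 2R}` of aspect `m` at scale `R`. -/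
def washer (m R : ℕ) : Set (Site 3) :=
  {z : Site 3 | |z 0| ≤ (m : ℤ) * (R : ℤ) ∧ (R : ℤ) ≤ max |z 1| |z 2| ∧ max |z 1| |z 2| ≤ 2 * (R : ℤ)}

/-- The radial crossing event of the washer: an open path inside `W_m(R)` from `ρ = R` to `ρ = 2R`
(same event shape as the route's `FlatAnnulusCrossing`, with thickness `k = m R`). -/
def washerCrossing (m R : ℕ) : Set (BondConfig (Site 3)) :=
  {ω | ∃ x y : Site 3, max |x 1| |x 2| = (R : ℤ) ∧ max |y 1| |y 2| = 2 * (R : ℤ) ∧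
    ω ∈ openConnIn (washer m R) x y}

/-- The one-arm event inside the cone: `x` is joined INSIDE `V_m` to a vertex of lateral radius `≥ n`. -/
def coneArm (m : ℕ) (x : Site 3) (n : ℕ) : Set (BondConfig (Site 3)) :=
  {ω | ∃ y : Site 3, (n : ℤ) ≤ max |y 1| |y 2| ∧ ω ∈ openConnIn (cone m) x y}

/-! ## The three stub statements -/

/-- STUB 1 statement (`FlatAnnulusCrossingAll`): all-aspect flat-washer RSW upper bound at `p_c(ℤ³)`,
uniform in the scale. -/
def WasherCrossingAllAspects : Prop :=
  ∀ m : ℕ, ∃ c : ℝ, 0 < c ∧ ∀ R : ℕ, 1 ≤ R → μc.real (washerCrossing m R) ≤ 1 - c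

/-- STUB 2 statement (dyadic glue): the washer bound forces the one-arm probability inside every cone
to tend to `0`. -/
def ConeArmDecayOfWashers : Prop :=
  WasherCrossingAllAspects → ∀ (m : ℕ) (x : Site 3), x ∈ cone m →
    Tendsto (fun n : ℕ => μc.real (coneArm m x n)) atTop (nhds 0)

/-- STUB 3 statement (coupling): `θ` of the induced cone graph is dominated by the one-arm probability
inside the cone at every scale. -/
def ThetaConeLeArm : Prop :=
  ∀ (m n : ℕ) (x : ↥(cone m)),
    theta ((zdGraph 3).induce (cone m)) x (criticalProbI 3) ≤ μc.real (coneArm m (x : Site 3) n)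

/-! ## Registered stubs -/

/-- **STUB 1 `washerCrossingAllAspects`** (XL, OPEN — LOAD-BEARING): `∀ m ∃ c > 0 ∀ R ≥ 1,
P_{p_c(ℤ³)}(W_m(R) crossed radially inside itself) ≤ 1 − c`. The route's `FlatAnnulusCrossing` is its
flat-aspect case; all aspects = flat aspect + aspect lifting (two-layer plan). Why it might fail: an RSW
upper bound uniform in the scale with no planar crossing/gluing input (transverse crossings of a 3D box
need not meet, `TransverseCrossingsNeedNotMeet`); thick washers are `X_B`-strength (bulk annulus
crossing bounds at `p_c`, open; the analogue fails for `d > 6`). Sources: arXiv:1512.09107 (NTW, slab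
RSW at `p_c(S_k)`), arXiv:1512.05178, Aizenman1997, BorgsChayesKestenSpencer1999, DuminilCopinICM2018. -/
theorem stub_washerCrossingAllAspects : WasherCrossingAllAspects := by
  sorry

/-- **STUB 2 `coneArmDecayOfWashers`** (M, PROVABLE NOW): STUB 1 → `∀ m, ∀ x ∈ V_m,
P_{p_c}(x ↔ {ρ ≥ n} inside V_m) → 0`. Dyadic washers `W_{2m}(4^i) ⊇ V_m ∩ {4^i ≤ ρ ≤ 2·4^i}`,
pairwise vertex-disjoint, each crossed by any long in-cone path (ρ moves by ≤ 1 per lattice step, a.s.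
`ω ⊆ E(ℤ³)` by `setBernoulli_ae_subset`), independent (events determined by disjoint edge sets), so the
arm probability is `≤ (1 − c_{2m})^{#scales} → 0`. -/
theorem stub_coneArmDecayOfWashers : ConeArmDecayOfWashers := by
  sorry

/-- **STUB 3 `thetaConeLeArm`** (S/M, PROVABLE NOW): `θ_{ℤ³[V_m]}(x, p_c) ≤ P_{p_c}(x ↔ {ρ ≥ n} inside
V_m)` for every `n`: `theta_induce_eq_real_percolatesVia`, finiteness of `V_m ∩ {ρ < n}`
(`|z₀| ≤ m ρ < m n`), and `percolatesVia (withinGraph G V_m) x ⊆ coneArm m x n`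
(`openConnIn_eq_openConnVia` + `withinGraph G ≤ withinGraph ⊤`). -/
theorem stub_thetaConeLeArm : ThetaConeLeArm := by
  sorry

/-! ### Name-keyed aliases of the stub statements
`__Registered.stub_X` is statement `X` under the registered stub's short name, so that the native skeleton
audit (`#h21_check_skeleton`: hypotheses admissible iff registered obligations / declared stubs BY NAME)
accepts `ConeRung_of : __Registered.stub_… → … → ConeRung` (device of
`Cruxes/BGNOffTheFloor/Lines/birth.lean`; the `@[stub]` attribute is gate-reserved). -/
namespace __Registered

/-- Alias of `WasherCrossingAllAspects` keyed by the registered stub name. -/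
abbrev stub_washerCrossingAllAspects : Prop := WasherCrossingAllAspects
/-- Alias of `ConeArmDecayOfWashers` keyed by the registered stub name. -/
abbrev stub_coneArmDecayOfWashers : Prop := ConeArmDecayOfWashers
/-- Alias of `ThetaConeLeArm` keyed by the registered stub name. -/
abbrev stub_thetaConeLeArm : Prop := ThetaConeLeArm

end __Registered

/-! ## Proved plumbing -/

/-- `θ ≥ 0` on the induced cone graph (it is a probability). -/
theorem theta_cone_nonneg (m : ℕ) (x : ↥(cone m)) :
    0 ≤ theta ((zdGraph 3).induce (cone m)) x (criticalProbI 3) := by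
  unfold theta
  exact measureReal_nonneg

/-- STUB 1 is at least the route's crux `FlatAnnulusCrossing` (its flat-aspect case, with `M = 1`):
a crossing inside the thinner washer `{|z₀| ≤ k} ∩ {R ≤ ρ ≤ 2R}`, `k ≤ R`, is a crossing inside
`W_1(R)`. -/
theorem flatAnnulusCrossing_of_washerAll (hW : WasherCrossingAllAspects) : FlatAnnulusCrossing := by
  obtain ⟨c, hc, hR⟩ := hW 1
  refine ⟨1, c, hc, fun k R hk hkR => ?_⟩
  have hR1 : 1 ≤ R := by omega
  have hkR' : (k : ℤ) ≤ ((1 : ℕ) : ℤ) * (R : ℤ) := by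
    push_cast
    rw [one_mul]
    exact_mod_cast (by omega : k ≤ R)
  refine le_trans (measureReal_mono ?_) (hR R hR1)
  rintro ω ⟨x, y, hx, hy, hω⟩
  refine ⟨x, y, hx, hy, openConnIn_mono ?_ x y hω⟩
  intro z hz
  simp only [Set.mem_setOf_eq] at hz
  exact ⟨hz.1.trans hkR', hz.2.1, hz.2.2⟩

/-! ## The composition, by name -/

/-- **`ConeRung_of`**: the three registered stubs imply the crux
`Summit.CriticalPhenomena.PercolationContinuityZ3.Theses.PercDivergentSlabLadder.ConeRung`
(kernel-checked; no `sorry` outside the stubs): `0 ≤ θ_{V_m}(x) ≤ P(x ↔ {ρ ≥ n} in V_m) → 0`. -/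
theorem ConeRung_of (hW : __Registered.stub_washerCrossingAllAspects)
    (hdecay : __Registered.stub_coneArmDecayOfWashers) (hle : __Registered.stub_thetaConeLeArm) :
    Summit.CriticalPhenomena.PercolationContinuityZ3.Theses.PercDivergentSlabLadder.ConeRung := by
  intro m x
  have ht : Tendsto (fun n : ℕ => μc.real (coneArm m (x : Site 3) n)) atTop (nhds 0) :=
    hdecay hW m x x.2
  have h0 : theta ((zdGraph 3).induce (cone m)) x (criticalProbI 3) ≤ 0 :=
    ge_of_tendsto' ht fun n => hle m n x
  exact le_antisymm h0 (theta_cone_nonneg m x)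

/-- Wiring check: the registered stubs feed `ConeRung_of` as stated. -/
example : Summit.CriticalPhenomena.PercolationContinuityZ3.Theses.PercDivergentSlabLadder.ConeRung :=
  ConeRung_of stub_washerCrossingAllAspects stub_coneArmDecayOfWashers stub_thetaConeLeArm

end Summit.CriticalPhenomena.PercolationContinuityZ3.Cruxes.ConeRung.Birth

end
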